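import Mathlib
import Summits.KontsevichZagierPeriods.KontsevichZagierPeriods.Theorems.CompiledSubstitutionsPiNormalisation
import Summits.KontsevichZagierPeriods.KontsevichZagierPeriods.Theorems.TorsionLogsGKZLevelThreePairBetaCubic
import HarnessLib

/-!
# `BetaLinearSector` (stmt-KontsevichZagierPeriods-3897), line `fermat-sector-transport` —
# stub `stub_lorentzHalfLine_equivalent_disc` (Euler reflection at `1/4`, step 4)

The last step of the level-4 rung of the crux `BetaLinearSector` (route FermatIsogeny): the
half-line Lorentzian representation of `π`,
`L = [(0,∞), 2 du/(1+u²)]`, is equivalent, inside the Kontsevich–Zagier calculus of moves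
(`Literature/NumberTheory/Transcendental/KZCalculus.lean`), to the closed-unit-disc representation
`P = [{x²+y² ≤ 1}, 1]` — for ANY representations with the displayed domains and integrands
agreeing with the displayed ones on them.

## Proof

ONE change of variables (rule (2), `KZ.changeOfVariablesRel`) by the Cayley map
`t = c(u) = (u−1)/(u+1)` from `(0,∞)` onto `(−1,1)` (`ℚ`-rational, `c'(u) = 2/(u+1)² > 0`,
injective since `c(u) = 1 − 2/(u+1)`, onto since `t = c((1+t)/(1−t))`), with the EXACT pull-back
identity `1 + c(u)² = 2(1+u²)/(u+1)²`, so `(2/(1+t²))∘c · |c'| = 2/(1+u²)`: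
this is `L ∼ T := [(−1,1), 2 dt/(1+t²)]` (`lorentzDisc_equivalent_arctan`; the representation `T`
exists, `exists_arctanRep`). The remaining link `T ∼ P` is the tree's arctangent normalisation of
`π` (`stub_piAsArctan`: substitution `x = 2t/(1+t²)` onto `[(-1,1), 1/√(1−x²)]`, then
Kontsevich–Zagier's own §1.1 Newton–Leibniz example and one Newton–Leibniz move along `y` to the
disc). No definitions are introduced (the substitution and its derivative are written out).

References: M. Kontsevich, D. Zagier, *Periods* (2001), §1.1 eq. (1), §1.2 rule (2).
-/

noncomputable section

namespace Summit.KontsevichZagierPeriods.FermatIsogeny.BetaLinearSector.Quarters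

open Set MeasureTheory
open MvPolynomial (aeval X C)
open Literature.NumberTheory.Transcendental Literature.NumberTheory.Transcendental.KZ
open Summit.KontsevichZagierPeriods.HermiteRigidity.CMTwistQuasiPeriodTransfer
  (of_sub_of_mem_changeOfVariablesRel_dimOne image_fin_one)
open Summit.KontsevichZagierPeriods.KontsevichZagierPeriods.Theorems.GKZLevelThree
  (isSemialgebraicFunOn_ratFun₁)
open Summit.KontsevichZagierPeriods.CompiledSubstitutions.PiNormalisation (exists_arctanRep)
open Summit.KontsevichZagierPeriods.KontsevichZagierPeriods.BetaCancellationLine (stub_piAsArctan)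

/-! ## The Cayley substitution `t = (u−1)/(u+1)` from `(0,∞)` onto `(−1,1)` -/

/-- The derivative of the Cayley map `c(u) = (u−1)/(u+1)` is `2/(u+1)²` (where `u + 1 ≠ 0`).
[folklore] -/
theorem lorentzDisc_hasDerivAt_cayley {u : ℝ} (hu : u + 1 ≠ 0) :
    HasDerivAt (fun u : ℝ => (u - 1) / (u + 1)) (2 / (u + 1) ^ 2) u := by
  have h1 : HasDerivAt (fun u : ℝ => u - 1) 1 u := (hasDerivAt_id u).sub_const 1
  have h2 : HasDerivAt (fun u : ℝ => u + 1) 1 u := (hasDerivAt_id u).add_const 1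
  exact (h1.div h2 hu).congr_deriv (by field_simp; ring)

/-- The Cayley map sends `(0,∞)` into `(−1,1)`. [folklore] -/
theorem lorentzDisc_cayley_mem_Ioo {u : ℝ} (hu : 0 < u) : (u - 1) / (u + 1) ∈ Ioo (-1:ℝ) 1 := by
  have hpos : (0:ℝ) < u + 1 := by linarith
  constructor
  · rw [lt_div_iff₀ hpos]
    linarith
  · rw [div_lt_one hpos]
    linarith

/-- The Cayley map sends `(0,∞)` ONTO `(−1,1)`: `t = c((1+t)/(1−t))`. [folklore] -/
theorem lorentzDisc_image_cayley :
    (fun u : ℝ => (u - 1) / (u + 1)) '' Ioi 0 = Ioo (-1:ℝ) 1 := by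
  apply Subset.antisymm
  · rintro _ ⟨u, hu, rfl⟩
    exact lorentzDisc_cayley_mem_Ioo hu
  · intro t ht
    have h1t : (0:ℝ) < 1 - t := by linarith [ht.2]
    refine ⟨(1 + t) / (1 - t), ?_, ?_⟩
    · show (0:ℝ) < (1 + t) / (1 - t)
      exact div_pos (by linarith [ht.1]) h1t
    · show ((1 + t) / (1 - t) - 1) / ((1 + t) / (1 - t) + 1) = t
      have hne : (1 - t) ≠ 0 := h1t.ne'
      field_simp
      ring

/-- The Cayley map is injective where `u + 1 ≠ 0` (`c(u) = 1 − 2/(u+1)`). [folklore] -/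
theorem lorentzDisc_cayley_inj {u v : ℝ} (hu : u + 1 ≠ 0) (hv : v + 1 ≠ 0)
    (h : (u - 1) / (u + 1) = (v - 1) / (v + 1)) : u = v := by
  rw [div_eq_div_iff hu hv] at h
  linear_combination h / 2

/-- The pull-back identity of the Cayley substitution, Jacobian included:
`2/(1 + c(u)²) · (2/(u+1)²) = 2/(1+u²)` for `u > 0` (`1 + c(u)² = 2(1+u²)/(u+1)²`). [folklore] -/
theorem lorentzDisc_cayley_pullback {u : ℝ} (hu : 0 < u) :
    2 / (1 + ((u - 1) / (u + 1)) ^ 2) * (2 / (u + 1) ^ 2) = 2 / (1 + u ^ 2) := by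
  have hpos : (0:ℝ) < u + 1 := by linarith
  have hne : (u + 1) ≠ 0 := hpos.ne'
  have hsq : 1 + ((u - 1) / (u + 1)) ^ 2 = 2 * (1 + u ^ 2) / (u + 1) ^ 2 := by
    field_simp
    ring
  have h1u : (0:ℝ) < 1 + u ^ 2 := by positivity
  rw [hsq]
  field_simp

/-- **The new move** (rule (2)): for any representation `L` with domain the half-line `(0,∞)` and
integrand `2/(1+u²)` on it, and `T = [(−1,1), 2/(1+t²)]`, the Cayley substitution
`t = (u−1)/(u+1)` gives `[L] − [T] ∈ KZ.relations`, i.e. `L ∼ T`.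
[cite: KontsevichZagier2001, §1.2 rule (2)] -/
theorem lorentzDisc_equivalent_arctan (L T : IntegralRep 1) (hLd : L.domain = {x | 0 < x 0})
    (hLi : EqOn L.integrand (fun x => 2 / (1 + (x 0) ^ 2)) L.domain)
    (hTd : T.domain = {x | x 0 ∈ Set.Ioo (-1:ℝ) 1})
    (hTi : T.integrand = fun x => 2 / (1 + x 0 ^ 2)) : Equivalent L T := by
  set φ : ℝ → ℝ := fun u => (u - 1) / (u + 1) with hφ
  set φ' : ℝ → ℝ := fun u => 2 / (u + 1) ^ 2 with hφ'
  have hmem : ∀ p ∈ L.domain, 0 < p 0 := fun p hp => by rw [hLd] at hp; exact hp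
  refine changeOfVariablesRel_subset_relations
    (of_sub_of_mem_changeOfVariablesRel_dimOne L T φ φ' ?_
      (fun p hp => lorentzDisc_hasDerivAt_cayley (by linarith [hmem p hp])) ?_ ?_ ?_)
  · refine isSemialgebraicFunOn_ratFun₁ L.isSemialgebraic_domain (X 0 - 1) (X 0 + 1) φ
      (fun x hx => ?_) (fun x _ => ?_)
    · simp only [map_add, map_one, MvPolynomial.aeval_X]
      linarith [hmem x hx]
    · simp [hφ]
  · intro p hp q hq h
    exact lorentzDisc_cayley_inj (by linarith [hmem p hp]) (by linarith [hmem q hq]) h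
  · rw [hTd, hLd]
    exact (image_fin_one (S := Ioi 0) lorentzDisc_image_cayley).symm
  · intro p hp
    have hp' : 0 < p 0 := hmem p hp
    have hpos : 0 < φ' (p 0) := by
      have : (0:ℝ) < p 0 + 1 := by linarith
      simp only [hφ']
      positivity
    rw [hLi hp, hTi, abs_of_pos hpos]
    exact (lorentzDisc_cayley_pullback hp').symm

/-! ## The stub -/

/-- **Step 4 of Euler's reflection at `1/4`** (line `fermat-sector-transport` of `BetaLinearSector`):
the half-line Lorentzian `[(0,∞), 2/(1+u²)]` (value `π`) is `KZ.Equivalent` to the closed unit disc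
`[{x²+y² ≤ 1}, 1]`, for any representations with these domains and integrands agreeing with the
displayed ones on them. Chain: `2/(1+u²) on (0,∞) —(t = (u−1)/(u+1))→ 2/(1+t²) on (−1,1)
—(stub_piAsArctan: x = 2t/(1+t²), KZ §1.1)→ disc`. [cite: KontsevichZagier2001, §1.1 eq. (1)] -/
theorem stub_lorentzHalfLine_equivalent_disc : ∀ (L : KZ.IntegralRep 1) (P : KZ.IntegralRep 2),
    L.domain = {x | 0 < x 0} → Set.EqOn L.integrand (fun x => 2 / (1 + (x 0) ^ 2)) L.domain →
    P.domain = {z | z 0 ^ 2 + z 1 ^ 2 ≤ 1} → Set.EqOn P.integrand (fun _ => 1) P.domain →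
    KZ.Equivalent L P := by
  intro L P hLd hLi hPd hPi
  obtain ⟨T, hTd, hTi⟩ := exists_arctanRep
  exact (lorentzDisc_equivalent_arctan L T hLd hLi hTd hTi).trans
    (stub_piAsArctan T P hTd (fun x _ => by rw [hTi]) hPd hPi)

end Summit.KontsevichZagierPeriods.FermatIsogeny.BetaLinearSector.Quarters

end
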